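import Summits.ResolutionOfSingularities.ResolutionOfSingularities.Theorems.PurelyInseparableDim4ResConeCInfGameStep
import Summits.ResolutionOfSingularities.ResolutionOfSingularities.Theorems.PurelyInseparableDim4ResConeCInfLegality
import HarnessLib
import HarnessLib.Audit.Tags

/-!
# Purely inseparable four-folds — the C∞ GAME READINGS in the window's binder shapes: LEGALITY, FLAGS and the
# BACKWARD LAW of one pure corner step, unguarded (cell `res-dim4-pi`, K2(p) lane, slice B; C∞ assembly K24c L2b)

[OURS · counted 0 · cell `res-dim4-pi` · K2(p) lane holder res-dim4-p-12 g3; C∞ assembly owner res-dim4-p-3 g4 (bus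
2026-08-29 03:37Z, design points (B)/(C)).]  Nothing here proves K2(p)/K2(5), `NoIsolatedTrap 5 5` or resolution of
singularities in dimension ≥ 4 / characteristic `p` — NOT proved.  AI kernel work, weaker than expert review.

The C∞ window game (res-dim4-p-9 g3's `CInfGame.Window.no_play_after_change`, p692304) is played on the supports
`P t (c,a,b,e) :⟺ c ≤ 3 ∧ coeff (E c a b e) F_{k+t} ≠ 0` of a framed chain, in res-dim4-p-2 g4's dictionary
`E(c,a,b,e) = (a+2)·κ + (b+2)·o + e·u + (3−c)·f` (`κ` the chart letter, `o` the other ledger letter; F2a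
`…ResConeCInfGameStep`).  F2a delivers the forward law and the backward law with the ledger exception; this file
delivers the three remaining per-step readings, STATE-LEVEL and WITHOUT degree guards (the pair ledger being exact,
`…ResConeExactPairLedger`):
* §1 `pair_add_resExp` — `r + m̃ = E(c,a,b,e)` for `r = e_κ + e_o`, `m̃ = (a+1)e_κ + (b+1)e_o + e·e_u + (3−c)e_f`
  (res-dim4-p-3 g3's F3 is stated on `m̃`); `straight_support_of_straight`, `le_degree_of_ordZero_eq`.
* §2 **`cInf_hleg_of_corner`** (LEGALITY = `hlegL` at a `κ = λ` step, `hlegM` at a `κ = μ` step after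
  `gameExp_swap`): in F3's frame at a state whose pure-corner child in chart `κ` is again in the regime
  (`ord₀ = 6`, `e_G = 3`), every present game monomial has `2c ≤ a + 2b + 2e` — F3's
  `cInf_legal_readings_of_corner` (iii) «no `κ`-blocker is present», with F2a's `le_of_coeff_gameExp_ne_zero`
  excluding the truncated corner.
* §3 **`cInf_hflag_of_isolated`** (FLAG = `hflagL` for `l = λ`, `hflagM` for `l = μ`): an ISOLATED state with ledger
  `r = e_l + e_o` and the exact support form «`f`-degree `≤ 3` ⇒ `x_l², x_o² ∣`» carries a game monomial with
  `b + e + 1 ≤ c` — F3's `cInf_flag_reading` witness IS a game monomial (`f`-degree `3` is impossible off the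
  window: `o`-exponent `≥ 1`), whatever its `x_l`-degree: no confinement needed.
* §4 `cInf_hevol_of_corner` — F2a's `exists_parent_of_coeff_step_zero_gameExp_of_ledger` with the exact ledger
  (`N = a′ + 8`): every present child game monomial has a present game parent, `a′ + c = a₀ + b + e`.

[cite: CossartJannsenSaito2020, Thm. 3.14, Lemma 13.2]
bears_on: LADDER-RESOLUTION:D157-DOOR2 (res-dim4-pi · K2(p) slice B · C∞ game readings).
Supports stmt-ResolutionOfSingularities-16155 (helper).
-/

set_option linter.dupNamespace false -- mandated namespace of this single-conjunct summit

noncomputable section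

namespace Summit.ResolutionOfSingularities.ResolutionOfSingularities.Theorems.PIDim4

namespace ResCone

open MvPolynomial Finset
open Literature.AlgebraicGeometry.Resolution
open Literature.AlgebraicGeometry.Resolution.CentreBlowup
open Literature.AlgebraicGeometry.Resolution.Hauser2010
open Literature.AlgebraicGeometry.Resolution.HauserPerlega2019

variable {K : Type} [Field K]

/-! ## §1 Bookkeeping: ledger + residual exponent = game exponent; straight support; degrees -/

section Letters

variable {κ o u f : Fin 4} (hκo : κ ≠ o) (hκu : κ ≠ u) (hκf : κ ≠ f) (hou : o ≠ u) (hof : o ≠ f) (huf : u ≠ f)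
include hκo hκu hκf hou hof huf

/-- `(e_κ + e_o) + ((a+1)e_κ + (b+1)e_o + e·e_u + g·e_f) = (a+2)e_κ + (b+2)e_o + e·e_u + g·e_f`. [OURS · bookkeeping] -/
theorem pair_add_resExp (a b e g : ℕ) :
    (Finsupp.single κ 1 + Finsupp.single o 1 : Fin 4 →₀ ℕ) +
        (Finsupp.single κ (a + 1) + Finsupp.single o (b + 1) + Finsupp.single u e + Finsupp.single f g) =
      Finsupp.single κ (a + 2) + Finsupp.single o (b + 2) + Finsupp.single u e + Finsupp.single f g := by
  obtain ⟨h1, h2, h3, h4⟩ := quad_apply hκo hκu hκf hou hof huf (a + 1) (b + 1) e g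
  obtain ⟨h1', h2', h3', h4'⟩ := quad_apply hκo hκu hκf hou hof huf (a + 2) (b + 2) e g
  obtain ⟨r1, r2, r3, r4⟩ := quad_apply hκo hκu hκf hou hof huf 1 1 0 0
  have hpair : (Finsupp.single κ 1 + Finsupp.single o 1 : Fin 4 →₀ ℕ) =
      Finsupp.single κ 1 + Finsupp.single o 1 + Finsupp.single u 0 + Finsupp.single f 0 := by
    rw [Finsupp.single_zero, Finsupp.single_zero, add_zero, add_zero]
  rw [hpair]
  ext k
  rcases letters_exhaust hκo hκu hκf hou hof huf k with h | h | h | h <;> rw [h, Finsupp.add_apply]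
  · rw [r1, h1, h1']; omega
  · rw [r2, h2, h2']; omega
  · rw [r3, h3, h3']; omega
  · rw [r4, h4, h4']; omega

end Letters

/-- Every monomial of a polynomial of order `o` has degree `≥ o`. [cite: ZariskiSamuel1960, Vol. II Ch. VII §1] -/
theorem le_degree_of_ordZero_eq {P : MvPolynomial (Fin 4) K} {o : ℕ} (ho : ordZero P = o) :
    ∀ d ∈ P.support, o ≤ d.degree := by
  intro d hd
  by_contra hlt
  exact (mem_support_iff.mp hd) (coeff_eq_zero_of_degree_lt_ordZero (by rw [ho]; exact_mod_cast not_le.mp hlt))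

/-- **Straight support**: if `x^r ∣ F` (`|r| = 2`) and the residual degree-`4` readings off `4e_f` vanish, every
degree-`6` monomial of `F` has `x_f`-exponent `4` (F2a's `hstraight`). [OURS · bookkeeping] -/
theorem straight_support_of_straight {f : Fin 4} {s : State K} (hdiv : ∀ e ∈ s.F.support, s.r ≤ e)
    (hrdeg : s.r.degree = 2) (hrf : s.r f = 0)
    (hstraight : ∀ m : Fin 4 →₀ ℕ, m.degree = 4 → m ≠ Finsupp.single f 4 → coeff (s.r + m) s.F = 0) :
    ∀ d ∈ s.F.support, d.degree = 6 → d f = 4 := by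
  intro d hd hdeg
  have hle := hdiv d hd
  have hd' : d = s.r + (d - s.r) := (add_tsub_cancel_of_le hle).symm
  have hmdeg : (d - s.r).degree = 4 := by
    have := congrArg Finsupp.degree hd'
    rw [map_add, hdeg, hrdeg] at this
    omega
  by_cases hm : d - s.r = Finsupp.single f 4
  · have := DFunLike.congr_fun hd' f
    rw [Finsupp.add_apply, hrf, hm, Finsupp.single_eq_same, zero_add] at this
    exact this
  · exfalso
    have h0 := hstraight (d - s.r) hmdeg hm
    rw [← hd'] at h0
    exact (mem_support_iff.mp hd) h0

/-! ## §2 LEGALITY of the letter played -/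

section Legality

variable [CharP K 5] [DecidableEq K]
variable {κ o u f : Fin 4} (hκo : κ ≠ o) (hκu : κ ≠ u) (hκf : κ ≠ f) (hou : o ≠ u) (hof : o ≠ f) (huf : u ≠ f)
include hκo hκu hκf hou hof huf

/-- **LEGALITY OF THE LETTER PLAYED** (`hlegL` / `hlegM` of res-dim4-p-9 g3's window, state-level, unguarded): in
the C∞ frame at a state `s` (`r = e_κ + e_o`, `x^r ∣ F`, `ord₀ F = 6`, straight: `coeff_{r+4e_f} F ≠ 0` and the other
residual degree-`4` readings vanish, Tschirnhaus/ledger row `coeff_{r+3e_f+2e_κ} F = 0`) whose PURE-CORNER child in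
the chart of `κ` has again `ord₀ = 6` and `e_G = 3`, every PRESENT game monomial
`E(c,a,b,e) = (a+2)e_κ + (b+2)e_o + e·e_u + (3−c)e_f` (`c ≤ 3`; `a` = exponent of the chart letter) satisfies
`2c ≤ a + 2b + 2e` — no `κ`-BLOCKER is present.  F3 `cInf_legal_readings_of_corner` (iii) on
`m̃ = (a+1, b+1, e, 3−c)` (`4 ≤ |m̃|` by F2a's `le_of_coeff_gameExp_ne_zero`, `2|m̃| ≤ m̃_κ + 8` iff
`a + 2b + 2e + 1 ≤ 2c`). [OURS] [cite: CossartJannsenSaito2020, Thm. 3.14] -/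
theorem cInf_hleg_of_corner {s : State K} (hr : s.r = Finsupp.single κ 1 + Finsupp.single o 1)
    (hdiv : ∀ e ∈ s.F.support, s.r ≤ e) (ho : ordZero s.F = (6 : ℕ))
    (ha : coeff (s.r + Finsupp.single f 4) s.F ≠ 0)
    (hstraight : ∀ m : Fin 4 →₀ ℕ, m.degree = 4 → m ≠ Finsupp.single f 4 → coeff (s.r + m) s.F = 0)
    (htsch : coeff (s.r + (Finsupp.single f 3 + Finsupp.single κ 2)) s.F = 0)
    (ho' : ordZero (CentreBlowup.step 5 Finset.univ κ 0 s).F = (6 : ℕ))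
    (he3' : Module.finrank K (resVertex (CentreBlowup.step 5 Finset.univ κ 0 s)) = 3)
    {c : ℕ} (hc : c ≤ 3) {a b e : ℕ}
    (h : coeff (Finsupp.single κ (a + 2) + Finsupp.single o (b + 2) + Finsupp.single u e +
      Finsupp.single f (3 - c)) s.F ≠ 0) : 2 * c ≤ a + 2 * b + 2 * e := by
  have hrdeg : s.r.degree = 2 := by rw [hr, map_add, Finsupp.degree_single, Finsupp.degree_single]
  have hrf : s.r f = 0 := by
    rw [hr, Finsupp.add_apply, Finsupp.single_eq_of_ne hκf.symm, Finsupp.single_eq_of_ne hof.symm, add_zero]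
  -- no truncation: `c ≤ a + b + e`
  have hle : c ≤ a + b + e :=
    le_of_coeff_gameExp_ne_zero hκo hκu hκf hou hof huf s (le_degree_of_ordZero_eq ho)
      (straight_support_of_straight hdiv hrdeg hrf hstraight) hc h
  -- F3 (iii): no `κ`-blocker among the residual exponents
  obtain ⟨-, -, hleg⟩ := cInf_legal_readings_of_corner hκo hκf hof hr hdiv ho ha hstraight htsch ho' he3'
  by_contra hlt
  rw [not_le] at hlt
  have hm := hleg (Finsupp.single κ (a + 1) + Finsupp.single o (b + 1) + Finsupp.single u e +
    Finsupp.single f (3 - c)) (by rw [degree_quad]; omega)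
    (by rw [degree_quad, (quad_apply hκo hκu hκf hou hof huf (a + 1) (b + 1) e (3 - c)).1]; omega)
    (fun heq => by
      have := DFunLike.congr_fun heq κ
      rw [(quad_apply hκo hκu hκf hou hof huf (a + 1) (b + 1) e (3 - c)).1, Finsupp.single_eq_of_ne hκf] at this
      omega)
  rw [hr, pair_add_resExp hκo hκu hκf hou hof huf] at hm
  exact h hm

end Legality

/-! ## §3 FLAGS from isolation -/

section Flag

variable {l o u f : Fin 4} (hlo : l ≠ o) (hlu : l ≠ u) (hlf : l ≠ f) (hou : o ≠ u) (hof : o ≠ f) (huf : u ≠ f)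
include hlo hlu hlf hou hof huf

/-- **THE FLAG OF A LEDGER LETTER from isolation** (`hflagL` for `l = λ`, `hflagM` for `l = μ`, state-level,
unguarded): an ISOLATED state with ledger `r = e_l + e_o`, `x^r ∣ F`, and the EXACT support form of the pair ledger
«every monomial of `x_f`-degree `≤ 3` has `x_l`-, `x_o`-exponents `≥ 2`» carries a PRESENT game monomial
`E(c,a,b,e) = (a+2)e_l + (b+2)e_o + e·e_u + (3−c)e_f`, `c ≤ 3`, with `b + e + 1 ≤ c` (an `l`-WITNESS).  The witness
of F3 `cInf_flag_reading` (`|m̃| ≤ m̃_l + 3`, so `x_f`-degree `≤ 3`) is a game monomial by the ledger (`m̃_l, m̃_o ≥ 1`,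
hence `x_f`-degree `≤ 2`); its `x_l`-degree is irrelevant. [OURS] [cite: CossartJannsenSaito2020, Thm. 3.14] -/
theorem cInf_hflag_of_isolated {s : State K} (hiso : IsIsolated 5 s.F) (hdiv : ∀ e ∈ s.F.support, s.r ≤ e)
    (hr : s.r = Finsupp.single l 1 + Finsupp.single o 1)
    (hled : ∀ e ∈ s.F.support, e f ≤ 3 → 2 ≤ e l ∧ 2 ≤ e o) :
    ∃ c a b e : ℕ, c ≤ 3 ∧
      coeff (Finsupp.single l (a + 2) + Finsupp.single o (b + 2) + Finsupp.single u e +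
        Finsupp.single f (3 - c)) s.F ≠ 0 ∧ b + e + 1 ≤ c := by
  have hrl : s.r l = 1 := by
    rw [hr, Finsupp.add_apply, Finsupp.single_eq_same, Finsupp.single_eq_of_ne hlo, add_zero]
  have hro : s.r o = 1 := by
    rw [hr, Finsupp.add_apply, Finsupp.single_eq_of_ne (Ne.symm hlo), Finsupp.single_eq_same, zero_add]
  have hrf : s.r f = 0 := by
    rw [hr, Finsupp.add_apply, Finsupp.single_eq_of_ne hlf.symm, Finsupp.single_eq_of_ne hof.symm, add_zero]
  have hrdeg : s.r.degree = 2 := by rw [hr, map_add, Finsupp.degree_single, Finsupp.degree_single]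
  obtain ⟨m, hm, hmdeg⟩ := cInf_flag_reading hiso hdiv hrl hrdeg
  have hmq := eq_sum_single_four hlo hlu hlf hou hof huf m
  have hmd : m.degree = m l + m o + m u + m f := by
    conv_lhs => rw [hmq]
    exact degree_quad l o u f _ _ _ _
  -- the witness lies in the support, with `x_f`-degree `≤ 3`: the ledger makes it a game monomial
  have hmem : s.r + m ∈ s.F.support := mem_support_iff.mpr hm
  have hmf3 : m f ≤ 3 := by omega
  obtain ⟨h2l, h2o⟩ := hled _ hmem (by rw [Finsupp.add_apply, hrf, zero_add]; exact hmf3)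
  rw [Finsupp.add_apply, hrl] at h2l
  rw [Finsupp.add_apply, hro] at h2o
  refine ⟨3 - m f, m l - 1, m o - 1, m u, by omega, ?_, by omega⟩
  have heq : (Finsupp.single l (m l - 1 + 2) + Finsupp.single o (m o - 1 + 2) + Finsupp.single u (m u) +
      Finsupp.single f (3 - (3 - m f)) : Fin 4 →₀ ℕ) = s.r + m := by
    rw [hr, show m l - 1 + 2 = (m l - 1) + 1 + 1 by omega, show m o - 1 + 2 = (m o - 1) + 1 + 1 by omega,
      show 3 - (3 - m f) = m f by omega, ← pair_add_resExp hlo hlu hlf hou hof huf,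
      show m l - 1 + 1 = m l by omega, show m o - 1 + 1 = m o by omega, ← hmq]
  rw [heq]
  exact hm

end Flag

/-! ## §4 The BACKWARD LAW with the exact ledger -/

section Backward

variable [DecidableEq K]
variable {κ o u f : Fin 4} (hκo : κ ≠ o) (hκu : κ ≠ u) (hκf : κ ≠ f) (hou : o ≠ u) (hof : o ≠ f) (huf : u ≠ f)
include hκo hκu hκf hou hof huf

/-- **BACKWARD LAW, unguarded** (the live branch of res-dim4-p-9 g3's `hevol`): with the EXACT support form at the
parent («`x_f`-degree `≤ 3` ⇒ `x_κ`-exponent `≥ 2`»), every game monomial `E(c, a′, b, e)` present at the pure-corner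
child in the chart of `κ` has a present game parent `E(c, a₀, b, e)` with `a′ + c = a₀ + b + e` — F2a's
`exists_parent_of_coeff_step_zero_gameExp_of_ledger` at `N = a′ + 8`. [OURS] [cite: CossartJannsenSaito2020, Lemma 13.2] -/
theorem cInf_hevol_of_corner (s : State K) (hr1 : ∀ d ∈ s.F.support, 1 ≤ d κ)
    (hled : ∀ d ∈ s.F.support, d f ≤ 3 → 2 ≤ d κ) {c : ℕ} (hc : c ≤ 3) {a' b e : ℕ}
    (h : coeff (Finsupp.single κ (a' + 2) + Finsupp.single o (b + 2) + Finsupp.single u e +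
      Finsupp.single f (3 - c)) (CentreBlowup.step 5 Finset.univ κ 0 s).F ≠ 0) :
    ∃ a₀, coeff (Finsupp.single κ (a₀ + 2) + Finsupp.single o (b + 2) + Finsupp.single u e +
        Finsupp.single f (3 - c)) s.F ≠ 0 ∧ a' + c = a₀ + b + e :=
  exists_parent_of_coeff_step_zero_gameExp_of_ledger hκo hκu hκf hou hof huf s hr1 (N := a' + 8)
    (fun d hd hdf _ => hled d hd hdf) hc (by omega) h

end Backward

end ResCone

end Summit.ResolutionOfSingularities.ResolutionOfSingularities.Theorems.PIDim4

end
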